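import Mathlib
import Summits.CriticalPhenomena.CardyFormulaZ2.Theorems.CardySelfRefinementDefs
import Summits.CriticalPhenomena.CardyFormulaZ2.Theorems.CardySelfRefinementTrivialSectorRateStubLocalEngineRotation
import Summits.CriticalPhenomena.CardyFormulaZ2.Theorems.CardySelfRefinementTrivialSectorRateStubLocalEngineRotationCoins
import Summits.CriticalPhenomena.CardyFormulaZ2.Theorems.CardySelfRefinementTrivialSectorRateStubLocalEngineRotationCond
import Summits.CriticalPhenomena.CardyFormulaZ2.Theorems.CardySelfRefinementTrivialSectorRateStubLocalEngineRotationWindow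
import Summits.CriticalPhenomena.CardyFormulaZ2.Theorems.CardySelfRefinementTrivialSectorRateStubLocalEngineOrbitOrder
import Literature.Probability.Percolation.SelfRefinementMeasure
import HarnessLib

/-!
# Stub `stub_localEngine` of line `far-field-is-a-quarter-turn` (crux `TrivialSectorRate`,
stmt-CriticalPhenomena-10266): the conditional orbit sums are the responses of ONE seed to the
`C₄`-orbit of the pair (boundary condition, event)

Companion of `…StubLocalEngineRotation[Coins|Cond|Window].lean` and `…StubLocalEngineOrbitOrder.lean`.
Setting of the engine `stub_localEngine`: window `K = coinWindow k (boxEdgesAt (ctr k u) R)` with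
`k ∣ R` (so that `σ ⁻¹' K = K`, `preimage_coinWindow_quarterTurn`), conditional law
`ν = (coinLaw k q).map (· ∩ K)`, a boundary condition `S₁ : Set Coin` (only `S₁ \ K` matters), an
event `B` of bond configurations read through `cfg k`, and the conditional signed influence
`Φ(S₁, B, i) = ν {T | insert i (T ∪ (S₁ \ K)) ∈ cfg k ⁻¹' B} − ν {T | (T ∪ (S₁ \ K)) \ {i} ∈ cfg k ⁻¹' B}`
of the coin `i` (written out inline everywhere, exactly in the engine's syntax).  The quarter turn
`g` about `k•u` and its coin permutation `σ` (formulas `hg`, `h0`, `h`) act on the pair by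
`(S₁, B) ↦ (σ ⁻¹' S₁, g '' B)`, `g '' B = BondConfig.relabel (sym2Equiv g.symm) ⁻¹' B`, and
`cond_infl_quarterTurn_window` becomes the ONE-STEP RULE

  `Φ(S₁, B, σ i) = Φ(σ ⁻¹' S₁, g '' B, i)`       (`cond_infl_at_quarterTurn_coin`),

equivalently `Φ(S₁, g '' B, i) = Φ(σ '' S₁, B, σ i)` (`cond_infl_quarterTurn_symm_window`, the
transport along the INVERSE quarter turn with the same window).  Iterating it along the `σ`-cycles
of `…OrbitOrder.lean` (`sum_bundlesAt_eq_orbit`, `sum_cellsAt_interiorEdges_eq_orbit`):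

* `bundleSum_cond_infl_eq_orbit` (registered): the `Tρ`-type conditional orbit sum
  `Σ_{b ∈ bundlesAt u} Φ(S₁, B, (b, 2))` equals `Σ_{j < 4} Φ(σ^{-j} S₁, g^{j} B, (u, 0, 2))`, the
  response of the EAST selector alone to the four rotated pairs — written as an explicit four-term
  sum (`j`-fold preimages under `σ`, `j`-fold preimages under `relabel (sym2Equiv g.symm)`);
* `cellSum_cond_infl_eq_orbit` (registered): the `Tc`-type double sum
  `Σ_{t ∈ cellsAt u} Σ_{e ∈ interiorEdges k t} Φ(S₁, B, (e, 0))` equals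
  `Σ_{j < 4} Σ_{e ∈ interiorEdges k u} Φ(σ^{-j} S₁, g^{j} B, (e, 0))`, the response of the interior
  edges of the north-east cell `u` alone;
* the relevance-type normalisers of the engine transform along the same orbit
  (`cond_real_cfg_mem_quarterTurn_window`, `cond_real_cfg_mem_quarterTurn_symm_window`).

Everything holds for ANY event `B` and ANY `S₁` (no measurability: the transports are measurable
equivalences).  By `quarterTurn_symm_eq_apply_three` / `quarterTurn_coin_symm_eq_apply_three`
(order four) the `g.symm`-preimages may be rewritten as triple `g`-preimages if preferred.
-/

noncomputable section

namespace Summit.CriticalPhenomena.CardyFormulaZ2.Theorems.CardySelfRefinement.FarField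

open Set MeasureTheory
open Literature.Probability.LatticeModels Literature.Probability.Percolation
open Literature.Probability.Percolation.QuadCrossing
open Summit.CriticalPhenomena.CardyFormulaZ2.Theses.CardySelfRefinement

/-! ### Rotating an event forth and back -/

/-- `{ω | g '' ω ∈ g '' B} = B`: the `g`-pull-back of the `g`-image event. -/
theorem relabel_preimage_relabel_symm_preimage (g : Site 2 ≃ Site 2) (B : Set (BondConfig (Site 2))) :
    BondConfig.relabel (sym2Equiv g) ⁻¹' (BondConfig.relabel (sym2Equiv g.symm) ⁻¹' B) = B := by
  ext ω
  simp only [Set.mem_preimage, relabel_symm_relabel]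

/-- `{ω | g⁻¹ '' ω ∈ {ω | g '' ω ∈ B}} = B`. -/
theorem relabel_symm_preimage_relabel_preimage (g : Site 2 ≃ Site 2) (B : Set (BondConfig (Site 2))) :
    BondConfig.relabel (sym2Equiv g.symm) ⁻¹' (BondConfig.relabel (sym2Equiv g) ⁻¹' B) = B := by
  have h := relabel_preimage_relabel_symm_preimage g.symm B
  rwa [Equiv.symm_symm] at h

/-! ### The one-step rule along the orbit -/

/-- **One step along the orbit** (`k ≠ 0`, `k ∣ R`; ANY `S₁`, `B`, `i`): the conditional signed
influence of the coin `σ i` for the pair `(S₁, B)` is that of the coin `i` for the rotated pair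
`(σ ⁻¹' S₁, g '' B)`, `g '' B = relabel (sym2Equiv g.symm) ⁻¹' B` — same window
`K = coinWindow k (boxEdgesAt (ctr k u) R)` and same conditional law on both sides. -/
theorem cond_infl_at_quarterTurn_coin {k : ℕ} (hk : k ≠ 0) (q : ℝ × ℝ) (u : Site 2)
    (g : Site 2 ≃ Site 2) (σ : Coin ≃ Coin)
    (hg : ∀ x, g x = ![ctr k u 0 + ctr k u 1 - x 1, x 0 - ctr k u 0 + ctr k u 1])
    (h0 : ∀ (v : Site 2) (d : Fin 2), σ (v, d, 0) =
      (![v 1 - ctr k u 1 + ctr k u 0, ctr k u 0 + ctr k u 1 - v 0 - (if d = 0 then 1 else 0)],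
        Equiv.swap 0 1 d, 0))
    (h : ∀ (t : Site 2) (d : Fin 2) (j : Fin 3), j ≠ 0 → σ (t, d, j) =
      (![t 1 - u 1 + u 0, u 0 + u 1 - t 0 - (if d = 0 then 1 else 0)], Equiv.swap 0 1 d, j))
    {R : ℕ} (hR : k ∣ R) (S₁ : Set Coin) (B : Set (BondConfig (Site 2)))
    (i : Coin) :
    (((coinLaw k q).map (fun T : Set Coin => T ∩ coinWindow k (boxEdgesAt (ctr k u) R))).real
        {T | insert (σ i) (T ∪ (S₁ \ coinWindow k (boxEdgesAt (ctr k u) R))) ∈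
          cfg k ⁻¹' B} -
      ((coinLaw k q).map (fun T : Set Coin => T ∩ coinWindow k (boxEdgesAt (ctr k u) R))).real
        {T | (T ∪ (S₁ \ coinWindow k (boxEdgesAt (ctr k u) R))) \ {σ i} ∈
          cfg k ⁻¹' B}) =
      (((coinLaw k q).map (fun T : Set Coin => T ∩ coinWindow k (boxEdgesAt (ctr k u) R))).real
          {T | insert i (T ∪ (σ ⁻¹' S₁ \ coinWindow k (boxEdgesAt (ctr k u) R))) ∈
            cfg k ⁻¹' (BondConfig.relabel (sym2Equiv g.symm) ⁻¹' B)} -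
        ((coinLaw k q).map (fun T : Set Coin => T ∩ coinWindow k (boxEdgesAt (ctr k u) R))).real
          {T | (T ∪ (σ ⁻¹' S₁ \ coinWindow k (boxEdgesAt (ctr k u) R))) \ {i} ∈
            cfg k ⁻¹' (BondConfig.relabel (sym2Equiv g.symm) ⁻¹' B)}) := by
  have e := cond_infl_quarterTurn_window hk q u g σ hg h0 h hR S₁
    (BondConfig.relabel (sym2Equiv g.symm) ⁻¹' B) (σ i)
  rw [relabel_preimage_relabel_symm_preimage, Equiv.symm_apply_apply] at e
  exact e

/-- **Transport along the INVERSE quarter turn, same window** (`k ≠ 0`, `k ∣ R`; ANY `S₁`, `B`,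
`i`): the conditional signed influence of `i` on the coin event of `g '' B = {ω | g⁻¹ '' ω ∈ B}`,
condition `S₁`, is that of `σ i` on the coin event of `B`, condition `σ '' S₁ = σ.symm ⁻¹' S₁`
(companion of `cond_infl_quarterTurn_window`, which transports along `g` itself). -/
theorem cond_infl_quarterTurn_symm_window {k : ℕ} (hk : k ≠ 0) (q : ℝ × ℝ) (u : Site 2)
    (g : Site 2 ≃ Site 2) (σ : Coin ≃ Coin)
    (hg : ∀ x, g x = ![ctr k u 0 + ctr k u 1 - x 1, x 0 - ctr k u 0 + ctr k u 1])
    (h0 : ∀ (v : Site 2) (d : Fin 2), σ (v, d, 0) =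
      (![v 1 - ctr k u 1 + ctr k u 0, ctr k u 0 + ctr k u 1 - v 0 - (if d = 0 then 1 else 0)],
        Equiv.swap 0 1 d, 0))
    (h : ∀ (t : Site 2) (d : Fin 2) (j : Fin 3), j ≠ 0 → σ (t, d, j) =
      (![t 1 - u 1 + u 0, u 0 + u 1 - t 0 - (if d = 0 then 1 else 0)], Equiv.swap 0 1 d, j))
    {R : ℕ} (hR : k ∣ R) (S₁ : Set Coin) (B : Set (BondConfig (Site 2)))
    (i : Coin) :
    (((coinLaw k q).map (fun T : Set Coin => T ∩ coinWindow k (boxEdgesAt (ctr k u) R))).real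
        {T | insert i (T ∪ (S₁ \ coinWindow k (boxEdgesAt (ctr k u) R))) ∈
          cfg k ⁻¹' (BondConfig.relabel (sym2Equiv g.symm) ⁻¹' B)} -
      ((coinLaw k q).map (fun T : Set Coin => T ∩ coinWindow k (boxEdgesAt (ctr k u) R))).real
        {T | (T ∪ (S₁ \ coinWindow k (boxEdgesAt (ctr k u) R))) \ {i} ∈
          cfg k ⁻¹' (BondConfig.relabel (sym2Equiv g.symm) ⁻¹' B)}) =
      (((coinLaw k q).map (fun T : Set Coin => T ∩ coinWindow k (boxEdgesAt (ctr k u) R))).real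
          {T | insert (σ i) (T ∪ (σ.symm ⁻¹' S₁ \ coinWindow k (boxEdgesAt (ctr k u) R))) ∈
            cfg k ⁻¹' B} -
        ((coinLaw k q).map (fun T : Set Coin => T ∩ coinWindow k (boxEdgesAt (ctr k u) R))).real
          {T | (T ∪ (σ.symm ⁻¹' S₁ \ coinWindow k (boxEdgesAt (ctr k u) R))) \ {σ i} ∈
            cfg k ⁻¹' B}) := by
  have e := cond_infl_at_quarterTurn_coin hk q u g σ hg h0 h hR (σ.symm ⁻¹' S₁) B i
  rw [Equiv.preimage_symm_preimage] at e
  exact e.symm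

/-! ### The `Tρ`-type conditional orbit sum -/

/-- **The `Tρ`-type conditional orbit sum is the response of the east selector to the `C₄`-orbit
of the pair** (`k ≠ 0`, `k ∣ R`; ANY boundary condition `S₁`, ANY event `B`; window
`K = coinWindow k (boxEdgesAt (ctr k u) R)`, law `ν = coinLaw ∘ (· ∩ K)⁻¹`):
`Σ_{b ∈ bundlesAt u} Φ(S₁, B, (b, 2)) = Σ_{j < 4} Φ(σ^{-j}(S₁), g^j(B), (u, 0, 2))`, where
`Φ(S, B, i) = ν {T | insert i (T ∪ (S \ K)) ∈ cfg k ⁻¹' B} − ν {T | (T ∪ (S \ K)) \ {i} ∈ cfg k ⁻¹' B}`,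
`σ^{-j}(S)` is the `j`-fold preimage under `σ` and `g^j(B)` the `j`-fold preimage under
`relabel (sym2Equiv g.symm)` (= `j`-fold image under `relabel (sym2Equiv g)`); the `j`-th term is
the influence of the selector of the `j`-th bundle of the cycle east, south, west, north. -/
theorem bundleSum_cond_infl_eq_orbit {k : ℕ} (hk : k ≠ 0) (q : ℝ × ℝ) (u : Site 2)
    (g : Site 2 ≃ Site 2) (σ : Coin ≃ Coin)
    (hg : ∀ x, g x = ![ctr k u 0 + ctr k u 1 - x 1, x 0 - ctr k u 0 + ctr k u 1])
    (h0 : ∀ (v : Site 2) (d : Fin 2), σ (v, d, 0) =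
      (![v 1 - ctr k u 1 + ctr k u 0, ctr k u 0 + ctr k u 1 - v 0 - (if d = 0 then 1 else 0)],
        Equiv.swap 0 1 d, 0))
    (h : ∀ (t : Site 2) (d : Fin 2) (j : Fin 3), j ≠ 0 → σ (t, d, j) =
      (![t 1 - u 1 + u 0, u 0 + u 1 - t 0 - (if d = 0 then 1 else 0)], Equiv.swap 0 1 d, j))
    {R : ℕ} (hR : k ∣ R) (S₁ : Set Coin) (B : Set (BondConfig (Site 2))) :
    ∑ b ∈ bundlesAt u,
        (((coinLaw k q).map (fun T : Set Coin => T ∩ coinWindow k (boxEdgesAt (ctr k u) R))).real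
            {T | insert (b.1, b.2, (2 : Fin 3)) (T ∪ (S₁ \ coinWindow k (boxEdgesAt (ctr k u) R))) ∈
              cfg k ⁻¹' B} -
          ((coinLaw k q).map (fun T : Set Coin => T ∩ coinWindow k (boxEdgesAt (ctr k u) R))).real
            {T | (T ∪ (S₁ \ coinWindow k (boxEdgesAt (ctr k u) R))) \ {(b.1, b.2, (2 : Fin 3))} ∈
              cfg k ⁻¹' B}) =
      (((coinLaw k q).map (fun T : Set Coin => T ∩ coinWindow k (boxEdgesAt (ctr k u) R))).real
          {T | insert (u, 0, (2 : Fin 3)) (T ∪ (S₁ \ coinWindow k (boxEdgesAt (ctr k u) R))) ∈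
            cfg k ⁻¹' B} -
        ((coinLaw k q).map (fun T : Set Coin => T ∩ coinWindow k (boxEdgesAt (ctr k u) R))).real
          {T | (T ∪ (S₁ \ coinWindow k (boxEdgesAt (ctr k u) R))) \ {(u, 0, (2 : Fin 3))} ∈
            cfg k ⁻¹' B}) +
      (((coinLaw k q).map (fun T : Set Coin => T ∩ coinWindow k (boxEdgesAt (ctr k u) R))).real
          {T | insert (u, 0, (2 : Fin 3)) (T ∪ (σ ⁻¹' S₁ \ coinWindow k (boxEdgesAt (ctr k u) R))) ∈
            cfg k ⁻¹' (BondConfig.relabel (sym2Equiv g.symm) ⁻¹' B)} -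
        ((coinLaw k q).map (fun T : Set Coin => T ∩ coinWindow k (boxEdgesAt (ctr k u) R))).real
          {T | (T ∪ (σ ⁻¹' S₁ \ coinWindow k (boxEdgesAt (ctr k u) R))) \ {(u, 0, (2 : Fin 3))} ∈
            cfg k ⁻¹' (BondConfig.relabel (sym2Equiv g.symm) ⁻¹' B)}) +
      (((coinLaw k q).map (fun T : Set Coin => T ∩ coinWindow k (boxEdgesAt (ctr k u) R))).real
          {T | insert (u, 0, (2 : Fin 3)) (T ∪ (σ ⁻¹' (σ ⁻¹' S₁) \ coinWindow k (boxEdgesAt (ctr k u) R))) ∈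
            cfg k ⁻¹' (BondConfig.relabel (sym2Equiv g.symm) ⁻¹' (BondConfig.relabel (sym2Equiv g.symm) ⁻¹' B))} -
        ((coinLaw k q).map (fun T : Set Coin => T ∩ coinWindow k (boxEdgesAt (ctr k u) R))).real
          {T | (T ∪ (σ ⁻¹' (σ ⁻¹' S₁) \ coinWindow k (boxEdgesAt (ctr k u) R))) \ {(u, 0, (2 : Fin 3))} ∈
            cfg k ⁻¹' (BondConfig.relabel (sym2Equiv g.symm) ⁻¹' (BondConfig.relabel (sym2Equiv g.symm) ⁻¹' B))}) +
      (((coinLaw k q).map (fun T : Set Coin => T ∩ coinWindow k (boxEdgesAt (ctr k u) R))).real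
          {T | insert (u, 0, (2 : Fin 3)) (T ∪ (σ ⁻¹' (σ ⁻¹' (σ ⁻¹' S₁)) \ coinWindow k (boxEdgesAt (ctr k u) R))) ∈
            cfg k ⁻¹'
          (BondConfig.relabel (sym2Equiv g.symm) ⁻¹' (BondConfig.relabel (sym2Equiv g.symm) ⁻¹' (BondConfig.relabel (sym2Equiv g.symm) ⁻¹' B)))} -
        ((coinLaw k q).map (fun T : Set Coin => T ∩ coinWindow k (boxEdgesAt (ctr k u) R))).real
          {T | (T ∪ (σ ⁻¹' (σ ⁻¹' (σ ⁻¹' S₁)) \ coinWindow k (boxEdgesAt (ctr k u) R))) \ {(u, 0, (2 : Fin 3))} ∈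
            cfg k ⁻¹'
          (BondConfig.relabel (sym2Equiv g.symm) ⁻¹' (BondConfig.relabel (sym2Equiv g.symm) ⁻¹' (BondConfig.relabel (sym2Equiv g.symm) ⁻¹' B)))}) := by
  rw [sum_bundlesAt_eq_orbit u σ h (j := 2) (by decide) fun i =>
    (((coinLaw k q).map (fun T : Set Coin => T ∩ coinWindow k (boxEdgesAt (ctr k u) R))).real
        {T | insert i (T ∪ (S₁ \ coinWindow k (boxEdgesAt (ctr k u) R))) ∈
          cfg k ⁻¹' B} -
      ((coinLaw k q).map (fun T : Set Coin => T ∩ coinWindow k (boxEdgesAt (ctr k u) R))).real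
        {T | (T ∪ (S₁ \ coinWindow k (boxEdgesAt (ctr k u) R))) \ {i} ∈
          cfg k ⁻¹' B})]
  simp only [cond_infl_at_quarterTurn_coin hk q u g σ hg h0 h hR]

/-! ### The `Tc`-type conditional orbit sum -/

/-- **The `Tc`-type conditional orbit sum is the response of the interior edges of the north-east
cell to the `C₄`-orbit of the pair** (`k ≠ 0`, `k ∣ R`; ANY `S₁`, `B`; notation as in
`bundleSum_cond_infl_eq_orbit`):
`Σ_{t ∈ cellsAt u} Σ_{e ∈ interiorEdges k t} Φ(S₁, B, (e, 0)) =
  Σ_{j < 4} Σ_{e ∈ interiorEdges k u} Φ(σ^{-j}(S₁), g^j(B), (e, 0))`;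
the `j`-th term collects the own coins of the interior edges of the `j`-th cell of the cycle
`u, u − e₁, u − e₀ − e₁, u − e₀`. -/
theorem cellSum_cond_infl_eq_orbit {k : ℕ} (hk : k ≠ 0) (q : ℝ × ℝ) (u : Site 2)
    (g : Site 2 ≃ Site 2) (σ : Coin ≃ Coin)
    (hg : ∀ x, g x = ![ctr k u 0 + ctr k u 1 - x 1, x 0 - ctr k u 0 + ctr k u 1])
    (h0 : ∀ (v : Site 2) (d : Fin 2), σ (v, d, 0) =
      (![v 1 - ctr k u 1 + ctr k u 0, ctr k u 0 + ctr k u 1 - v 0 - (if d = 0 then 1 else 0)],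
        Equiv.swap 0 1 d, 0))
    (h : ∀ (t : Site 2) (d : Fin 2) (j : Fin 3), j ≠ 0 → σ (t, d, j) =
      (![t 1 - u 1 + u 0, u 0 + u 1 - t 0 - (if d = 0 then 1 else 0)], Equiv.swap 0 1 d, j))
    {R : ℕ} (hR : k ∣ R) (S₁ : Set Coin) (B : Set (BondConfig (Site 2))) :
    ∑ t ∈ cellsAt u, ∑ e ∈ interiorEdges k t,
        (((coinLaw k q).map (fun T : Set Coin => T ∩ coinWindow k (boxEdgesAt (ctr k u) R))).real
            {T | insert (e.1, e.2, (0 : Fin 3)) (T ∪ (S₁ \ coinWindow k (boxEdgesAt (ctr k u) R))) ∈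
              cfg k ⁻¹' B} -
          ((coinLaw k q).map (fun T : Set Coin => T ∩ coinWindow k (boxEdgesAt (ctr k u) R))).real
            {T | (T ∪ (S₁ \ coinWindow k (boxEdgesAt (ctr k u) R))) \ {(e.1, e.2, (0 : Fin 3))} ∈
              cfg k ⁻¹' B}) =
      ∑ e ∈ interiorEdges k u,
        (((coinLaw k q).map (fun T : Set Coin => T ∩ coinWindow k (boxEdgesAt (ctr k u) R))).real
            {T | insert (e.1, e.2, (0 : Fin 3)) (T ∪ (S₁ \ coinWindow k (boxEdgesAt (ctr k u) R))) ∈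
              cfg k ⁻¹' B} -
          ((coinLaw k q).map (fun T : Set Coin => T ∩ coinWindow k (boxEdgesAt (ctr k u) R))).real
            {T | (T ∪ (S₁ \ coinWindow k (boxEdgesAt (ctr k u) R))) \ {(e.1, e.2, (0 : Fin 3))} ∈
              cfg k ⁻¹' B}) +
      ∑ e ∈ interiorEdges k u,
        (((coinLaw k q).map (fun T : Set Coin => T ∩ coinWindow k (boxEdgesAt (ctr k u) R))).real
            {T | insert (e.1, e.2, (0 : Fin 3)) (T ∪ (σ ⁻¹' S₁ \ coinWindow k (boxEdgesAt (ctr k u) R))) ∈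
              cfg k ⁻¹' (BondConfig.relabel (sym2Equiv g.symm) ⁻¹' B)} -
          ((coinLaw k q).map (fun T : Set Coin => T ∩ coinWindow k (boxEdgesAt (ctr k u) R))).real
            {T | (T ∪ (σ ⁻¹' S₁ \ coinWindow k (boxEdgesAt (ctr k u) R))) \ {(e.1, e.2, (0 : Fin 3))} ∈
              cfg k ⁻¹' (BondConfig.relabel (sym2Equiv g.symm) ⁻¹' B)}) +
      ∑ e ∈ interiorEdges k u,
        (((coinLaw k q).map (fun T : Set Coin => T ∩ coinWindow k (boxEdgesAt (ctr k u) R))).real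
            {T | insert (e.1, e.2, (0 : Fin 3)) (T ∪ (σ ⁻¹' (σ ⁻¹' S₁) \ coinWindow k (boxEdgesAt (ctr k u) R))) ∈
              cfg k ⁻¹' (BondConfig.relabel (sym2Equiv g.symm) ⁻¹' (BondConfig.relabel (sym2Equiv g.symm) ⁻¹' B))} -
          ((coinLaw k q).map (fun T : Set Coin => T ∩ coinWindow k (boxEdgesAt (ctr k u) R))).real
            {T | (T ∪ (σ ⁻¹' (σ ⁻¹' S₁) \ coinWindow k (boxEdgesAt (ctr k u) R))) \ {(e.1, e.2, (0 : Fin 3))} ∈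
              cfg k ⁻¹' (BondConfig.relabel (sym2Equiv g.symm) ⁻¹' (BondConfig.relabel (sym2Equiv g.symm) ⁻¹' B))}) +
      ∑ e ∈ interiorEdges k u,
        (((coinLaw k q).map (fun T : Set Coin => T ∩ coinWindow k (boxEdgesAt (ctr k u) R))).real
            {T | insert (e.1, e.2, (0 : Fin 3)) (T ∪ (σ ⁻¹' (σ ⁻¹' (σ ⁻¹' S₁)) \ coinWindow k (boxEdgesAt (ctr k u) R))) ∈
              cfg k ⁻¹'
          (BondConfig.relabel (sym2Equiv g.symm) ⁻¹' (BondConfig.relabel (sym2Equiv g.symm) ⁻¹' (BondConfig.relabel (sym2Equiv g.symm) ⁻¹' B)))} -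
          ((coinLaw k q).map (fun T : Set Coin => T ∩ coinWindow k (boxEdgesAt (ctr k u) R))).real
            {T | (T ∪ (σ ⁻¹' (σ ⁻¹' (σ ⁻¹' S₁)) \ coinWindow k (boxEdgesAt (ctr k u) R))) \ {(e.1, e.2, (0 : Fin 3))} ∈
              cfg k ⁻¹'
          (BondConfig.relabel (sym2Equiv g.symm) ⁻¹' (BondConfig.relabel (sym2Equiv g.symm) ⁻¹' (BondConfig.relabel (sym2Equiv g.symm) ⁻¹' B)))}) := by
  rw [sum_cellsAt_interiorEdges_eq_orbit (Nat.pos_of_ne_zero hk) u σ h0 fun i =>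
    (((coinLaw k q).map (fun T : Set Coin => T ∩ coinWindow k (boxEdgesAt (ctr k u) R))).real
        {T | insert i (T ∪ (S₁ \ coinWindow k (boxEdgesAt (ctr k u) R))) ∈
          cfg k ⁻¹' B} -
      ((coinLaw k q).map (fun T : Set Coin => T ∩ coinWindow k (boxEdgesAt (ctr k u) R))).real
        {T | (T ∪ (S₁ \ coinWindow k (boxEdgesAt (ctr k u) R))) \ {i} ∈
          cfg k ⁻¹' B})]
  simp only [cond_infl_at_quarterTurn_coin hk q u g σ hg h0 h hR]

/-! ### The normalisers along the orbit -/

/-- **The relevance-type normaliser along the quarter turn, same window** (`k ≠ 0`, `k ∣ R`; ANY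
`S₁`, `B`): `ν {T | cfg k (T ∪ (S₁ \ K)) ∈ {ω | g '' ω ∈ B}} = ν {T | cfg k (T ∪ (σ ⁻¹' S₁ \ K)) ∈ B}`
(`cond_real_cfg_mem_quarterTurn` with `σ ⁻¹' K = K`). -/
theorem cond_real_cfg_mem_quarterTurn_window {k : ℕ} (hk : k ≠ 0) (q : ℝ × ℝ) (u : Site 2)
    (g : Site 2 ≃ Site 2) (σ : Coin ≃ Coin)
    (hg : ∀ x, g x = ![ctr k u 0 + ctr k u 1 - x 1, x 0 - ctr k u 0 + ctr k u 1])
    (h0 : ∀ (v : Site 2) (d : Fin 2), σ (v, d, 0) =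
      (![v 1 - ctr k u 1 + ctr k u 0, ctr k u 0 + ctr k u 1 - v 0 - (if d = 0 then 1 else 0)],
        Equiv.swap 0 1 d, 0))
    (h : ∀ (t : Site 2) (d : Fin 2) (j : Fin 3), j ≠ 0 → σ (t, d, j) =
      (![t 1 - u 1 + u 0, u 0 + u 1 - t 0 - (if d = 0 then 1 else 0)], Equiv.swap 0 1 d, j))
    {R : ℕ} (hR : k ∣ R) (S₁ : Set Coin) (B : Set (BondConfig (Site 2))) :
    ((coinLaw k q).map (fun T : Set Coin => T ∩ coinWindow k (boxEdgesAt (ctr k u) R))).real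
      {T | cfg k (T ∪ (S₁ \ coinWindow k (boxEdgesAt (ctr k u) R))) ∈ BondConfig.relabel (sym2Equiv g) ⁻¹' B} =
      ((coinLaw k q).map (fun T : Set Coin => T ∩ coinWindow k (boxEdgesAt (ctr k u) R))).real
        {T | cfg k (T ∪ (σ ⁻¹' S₁ \ coinWindow k (boxEdgesAt (ctr k u) R))) ∈ B} := by
  have e := cond_real_cfg_mem_quarterTurn hk q u g σ hg h0 h (coinWindow k (boxEdgesAt (ctr k u) R)) S₁ B
  rwa [preimage_coinWindow_quarterTurn (Nat.pos_of_ne_zero hk) u σ h0 h hR] at e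

/-- The same along the INVERSE quarter turn:
`ν {T | cfg k (T ∪ (S₁ \ K)) ∈ g '' B} = ν {T | cfg k (T ∪ (σ '' S₁ \ K)) ∈ B}`
(`g '' B = relabel (sym2Equiv g.symm) ⁻¹' B`, `σ '' S₁ = σ.symm ⁻¹' S₁`). -/
theorem cond_real_cfg_mem_quarterTurn_symm_window {k : ℕ} (hk : k ≠ 0) (q : ℝ × ℝ) (u : Site 2)
    (g : Site 2 ≃ Site 2) (σ : Coin ≃ Coin)
    (hg : ∀ x, g x = ![ctr k u 0 + ctr k u 1 - x 1, x 0 - ctr k u 0 + ctr k u 1])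
    (h0 : ∀ (v : Site 2) (d : Fin 2), σ (v, d, 0) =
      (![v 1 - ctr k u 1 + ctr k u 0, ctr k u 0 + ctr k u 1 - v 0 - (if d = 0 then 1 else 0)],
        Equiv.swap 0 1 d, 0))
    (h : ∀ (t : Site 2) (d : Fin 2) (j : Fin 3), j ≠ 0 → σ (t, d, j) =
      (![t 1 - u 1 + u 0, u 0 + u 1 - t 0 - (if d = 0 then 1 else 0)], Equiv.swap 0 1 d, j))
    {R : ℕ} (hR : k ∣ R) (S₁ : Set Coin)
    (B : Set (BondConfig (Site 2))) :
    ((coinLaw k q).map (fun T : Set Coin => T ∩ coinWindow k (boxEdgesAt (ctr k u) R))).real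
      {T | cfg k (T ∪ (S₁ \ coinWindow k (boxEdgesAt (ctr k u) R))) ∈ BondConfig.relabel (sym2Equiv g.symm) ⁻¹' B} =
      ((coinLaw k q).map (fun T : Set Coin => T ∩ coinWindow k (boxEdgesAt (ctr k u) R))).real
        {T | cfg k (T ∪ (σ.symm ⁻¹' S₁ \ coinWindow k (boxEdgesAt (ctr k u) R))) ∈ B} := by
  have e := cond_real_cfg_mem_quarterTurn_window hk q u g σ hg h0 h hR (σ.symm ⁻¹' S₁)
    (BondConfig.relabel (sym2Equiv g.symm) ⁻¹' B)
  rw [relabel_preimage_relabel_symm_preimage, Equiv.preimage_symm_preimage] at e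
  exact e.symm

/-- One step along the orbit for the normaliser, in the direction of `cond_infl_at_quarterTurn_coin`:
`ν {T | cfg k (T ∪ (σ ⁻¹' S₁ \ K)) ∈ g '' B} = ν {T | cfg k (T ∪ (S₁ \ K)) ∈ B}` — the normaliser is
CONSTANT along the orbit of the pair whenever `B` is `g`-invariant. -/
theorem cond_real_cfg_mem_orbit_step {k : ℕ} (hk : k ≠ 0) (q : ℝ × ℝ) (u : Site 2)
    (g : Site 2 ≃ Site 2) (σ : Coin ≃ Coin)
    (hg : ∀ x, g x = ![ctr k u 0 + ctr k u 1 - x 1, x 0 - ctr k u 0 + ctr k u 1])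
    (h0 : ∀ (v : Site 2) (d : Fin 2), σ (v, d, 0) =
      (![v 1 - ctr k u 1 + ctr k u 0, ctr k u 0 + ctr k u 1 - v 0 - (if d = 0 then 1 else 0)],
        Equiv.swap 0 1 d, 0))
    (h : ∀ (t : Site 2) (d : Fin 2) (j : Fin 3), j ≠ 0 → σ (t, d, j) =
      (![t 1 - u 1 + u 0, u 0 + u 1 - t 0 - (if d = 0 then 1 else 0)], Equiv.swap 0 1 d, j))
    {R : ℕ} (hR : k ∣ R) (S₁ : Set Coin) (B : Set (BondConfig (Site 2))) :
    ((coinLaw k q).map (fun T : Set Coin => T ∩ coinWindow k (boxEdgesAt (ctr k u) R))).real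
      {T | cfg k (T ∪ (σ ⁻¹' S₁ \ coinWindow k (boxEdgesAt (ctr k u) R))) ∈ BondConfig.relabel (sym2Equiv g.symm) ⁻¹' B} =
      ((coinLaw k q).map (fun T : Set Coin => T ∩ coinWindow k (boxEdgesAt (ctr k u) R))).real
        {T | cfg k (T ∪ (S₁ \ coinWindow k (boxEdgesAt (ctr k u) R))) ∈ B} := by
  rw [cond_real_cfg_mem_quarterTurn_symm_window hk q u g σ hg h0 h hR, Equiv.symm_preimage_preimage]

end Summit.CriticalPhenomena.CardyFormulaZ2.Theorems.CardySelfRefinement.FarField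

end
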